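import Summits.MatrixMultiplication.MatrixMultiplication.Theses.NilpotentLieHosts

/-!
# `NilpotentLieHosts.ObstructionKillsHeisenberg` — the Heisenberg obstruction refutes the Heisenberg designs

Route `MatrixMultiplication/NilpotentLieHosts`, support item `stmt-MatrixMultiplication-7728`:
`HeisenbergThresholdObstruction → ¬ HeisenbergThresholdDesigns`.

Pure exponent bookkeeping over `ℝ`.  The obstruction supplies `c > 0` and `C` with
`|X||Y||Z| ≤ C (s+1)^(9/2 - c)` for every TPP triple in `U_3(ℤ)` with weighted-degree-`≤ s` separating
polynomials; the design half, fed the loss `δ := c/2`, supplies such triples at unboundedly large budgets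
`s` with `s^(9/2 - c/2) ≤ |X||Y||Z|`.  With `F := 9/2 - c` and `(s+1)^F ≤ max 1 2^F · s^F` for `s ≥ 1`
this reads `s^(c/2) · s^F ≤ max C 1 · max 1 2^F · s^F`, i.e. `s^(c/2) ≤ max C 1 · max 1 2^F`, which
fails as soon as `s^(c/2)` exceeds that constant (`tendsto_rpow_atTop`).  The argument is the `d = 3`
shadow of the route's deciding theorem `closes` and uses nothing about matrices or polynomials.
-/

-- D-0017: `<Problem> = <Summit>` duplicates `MatrixMultiplication` in every name here by design.
set_option linter.dupNamespace false

namespace Summit.MatrixMultiplication.MatrixMultiplication.Theorems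

open Summit.MatrixMultiplication.MatrixMultiplication.Theses.NilpotentLieHosts

/-- **The Heisenberg obstruction kills the Heisenberg designs** (item `stmt-MatrixMultiplication-7728`):
a power saving `|X||Y||Z| ≤ C (s+1)^(9/2 - c)`, `c > 0`, for all TPP triples in `U_3(ℤ)` with
weighted-degree-`≤ s` separating polynomials is incompatible with designs of size `≥ s^(9/2 - δ)` for
every `δ > 0` at unboundedly large `s`: take `δ = c/2` and `s` large against `max C 1 · max 1 2^(9/2-c)`. -/
theorem obstructionKillsHeisenberg_proof : ObstructionKillsHeisenberg := by
  unfold ObstructionKillsHeisenberg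
  intro hObs hDes
  obtain ⟨c, hc, C, hC⟩ := hObs
  -- the loss `δ = g = c/2` fed to the design half, the obstruction exponent `F = 9/2 - c`
  set F : ℝ := (9 : ℝ) / 2 - c with hFdef
  set g : ℝ := c / 2 with hgdef
  have hg : 0 < g := half_pos hc
  have hexp : (9 : ℝ) / 2 - g = g + F := by
    rw [hgdef, hFdef]
    ring
  -- constants: `C' = max C 1` and `K = max 1 2^F` with `(s+1)^F ≤ K·s^F` for `s ≥ 1`
  set C' : ℝ := max C 1 with hC'def
  set K : ℝ := max 1 ((2 : ℝ) ^ F) with hKdef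
  have hC'1 : 1 ≤ C' := le_max_right _ _
  have hK1 : 1 ≤ K := le_max_left _ _
  have hC'0 : 0 ≤ C' := zero_le_one.trans hC'1
  -- `x ↦ x^g` is unbounded: beyond `M` it exceeds `C'·K + 1`
  obtain ⟨M, hM⟩ := Filter.tendsto_atTop_atTop.1 (tendsto_rpow_atTop hg) (C' * K + 1)
  -- a design at a budget `s ≥ max 1 ⌈M⌉₊`, and its obstruction bound
  obtain ⟨s, hs, X, Y, Z, hU, hT, hS, hV⟩ := hDes g hg (max 1 (Nat.ceil M))
  have hs1 : 1 ≤ s := (le_max_left _ _).trans hs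
  have hsM : M ≤ (s : ℝ) :=
    (Nat.le_ceil M).trans (by exact_mod_cast (le_max_right 1 (Nat.ceil M)).trans hs)
  have hsR1 : (1 : ℝ) ≤ s := by exact_mod_cast hs1
  have hsR0 : (0 : ℝ) < s := one_pos.trans_le hsR1
  have hcost := hC s X Y Z hU hT hS
  -- real bookkeeping
  have hsF : (0 : ℝ) < (s : ℝ) ^ F := Real.rpow_pos_of_pos hsR0 F
  have h1 : (s : ℝ) ^ g * (s : ℝ) ^ F ≤ (X.card : ℝ) * Y.card * Z.card := by
    rw [← Real.rpow_add hsR0, ← hexp]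
    exact hV
  have h2 : C * ((s : ℝ) + 1) ^ F ≤ C' * (K * (s : ℝ) ^ F) := by
    have hs1F : (0 : ℝ) ≤ ((s : ℝ) + 1) ^ F := Real.rpow_nonneg (by positivity) F
    have h3 : ((s : ℝ) + 1) ^ F ≤ K * (s : ℝ) ^ F := by
      rcases le_or_gt 0 F with hF | hF
      · calc ((s : ℝ) + 1) ^ F ≤ (2 * (s : ℝ)) ^ F :=
              Real.rpow_le_rpow (by positivity) (by linarith) hF
          _ = (2 : ℝ) ^ F * (s : ℝ) ^ F := Real.mul_rpow zero_le_two hsR0.le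
          _ ≤ K * (s : ℝ) ^ F := mul_le_mul_of_nonneg_right (le_max_right _ _) hsF.le
      · calc ((s : ℝ) + 1) ^ F ≤ (s : ℝ) ^ F :=
              Real.rpow_le_rpow_of_nonpos hsR0 (by linarith) hF.le
          _ = 1 * (s : ℝ) ^ F := (one_mul _).symm
          _ ≤ K * (s : ℝ) ^ F := mul_le_mul_of_nonneg_right hK1 hsF.le
    calc C * ((s : ℝ) + 1) ^ F ≤ C' * ((s : ℝ) + 1) ^ F :=
          mul_le_mul_of_nonneg_right (le_max_left _ _) hs1F
      _ ≤ C' * (K * (s : ℝ) ^ F) := mul_le_mul_of_nonneg_left h3 hC'0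
  have h4 : (s : ℝ) ^ g * (s : ℝ) ^ F ≤ C' * K * (s : ℝ) ^ F := by
    rw [mul_assoc]
    exact h1.trans (hcost.trans h2)
  have h5 : (s : ℝ) ^ g ≤ C' * K := le_of_mul_le_mul_right h4 hsF
  have h6 : C' * K + 1 ≤ (s : ℝ) ^ g := hM (s : ℝ) hsM
  linarith

end Summit.MatrixMultiplication.MatrixMultiplication.Theorems
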